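/-
Copyright (c) 2026. All rights reserved.
Released under Apache 2.0 license as described in the file LICENSE.
Authors: abc-iut cell, campaign-S prover seat abc-iut-S1 (gen 2).
-/
import Literature.IUT.LogVolume.DifferentOrdDivisor
import Literature.IUT.LogVolume.FakeAdeleIndexLocalDegree
import HarnessLib

/-!
# [IUTchIV] Def. 1.9: `deg(𝔡^F_ADiv) = Σ_v [F_v : ℚ_{p_v}]·d_v·log p_v`

The global different divisor of a number field `F` (`differentDivisor F = Σ_v ord_v(𝔇_{F/ℤ})·v`, [GenEll] Def. 1.5 (iii),
`degF_differentDivisor : deg = log N(𝔇)`) has degree equal to the sum over the finite places of the LOCAL terms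
`n_v·d_v·log p_v`, where `p_v = residueChar F v`, `n_v = localDeg F v = e_v f_v = [F_v:ℚ_{p_v}]` and
`d_v = differentOrd p_v F_v` is the normalised order of the different of the completion (rescaled presentation,
abc-iut-S7's `RescaledCompletion`) — i.e. [IUTchIV] Def. 1.9's `log(𝔡^F) := (1/[F:ℚ])·deg_{ADiv}(𝔡^F)` (p. 21; p. 23 for
`log(𝔡^F_v)`) computed place by place from the local differents of [IUTchIV] Props. 1.1–1.4, via
`DifferentOrdDivisor.multiplicity_mul_logNorm_eq` (Serre, *Local Fields* III §4 Prop. 10); `p_v ∈ v` is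
`FakeAdeleIndexLocalDegree.natCast_residueChar_mem`.  THEOREMS ONLY; classical;
nothing here bears on the disputed [IUTchIII] Cor. 3.12.
-/

noncomputable section

open scoped NumberField

namespace Literature.IUT.LogVolume

open NumberField IsDedekindDomain Literature.NumberTheory.NumberFields

variable (F : Type) [Field F] [NumberField F]

/-- **[IUTchIV] Def. 1.9, place by place**: `deg(𝔡^F_ADiv) = Σ_{v ∣ 𝔇} n_v·d_v·log p_v` with `n_v = [F_v:ℚ_{p_v}]` and
`d_v = differentOrd p_v F_v` the normalised different order of the completion — the global log-different is the sum of
the local different terms of [IUTchIV] §1. [cite: Mochizuki2012, IUTchIV Def. 1.9 p. 21] -/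
theorem degF_differentDivisor_eq_sum_local :
    degF F (differentDivisor F) =
      ∑ v ∈ (finite_setOf_multiplicity_ne_zero F (differentIdeal_ne_bot' F)).toFinset,
        (haveI : Fact (residueChar F v).Prime := ⟨residueChar_prime F v⟩
         (localDeg F v : ℝ) *
            differentOrd (residueChar F v) (RescaledCompletion F (residueChar F v) v (natCast_residueChar_mem F v)) *
          Real.log (residueChar F v)) := by
  have hI := differentIdeal_ne_bot' F
  set T := (finite_setOf_multiplicity_ne_zero F hI).toFinset with hT
  -- the degree as the sum `Σ_{v ∈ T} ord_v(𝔇)·log 𝐍(v)`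
  have hdeg : degF F (differentDivisor F) =
      ∑ v ∈ T, (multiplicity v.asIdeal (differentIdeal ℤ (𝓞 F)) : ℝ) * logNorm F v := by
    rw [differentDivisor, degF_apply, ADivisor.ofIdeal, dif_neg hI, Finsupp.sum_sumElim, Finsupp.sum_zero_index,
      zero_add]
    rw [Finsupp.sum_of_support_subset _ (s := T) ?_ _ (fun v _ => by simp)]
    · refine Finset.sum_congr rfl fun v _ => ?_
      simp [Finsupp.ofSupportFinite_coe, logNorm, degWeight]
    · intro v hv
      rw [Finsupp.mem_support_iff, Finsupp.ofSupportFinite_coe] at hv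
      rw [hT, Set.Finite.mem_toFinset]
      exact fun h => hv (by simp [h])
  rw [hdeg]
  refine Finset.sum_congr rfl fun v _ => ?_
  haveI : Fact (residueChar F v).Prime := ⟨residueChar_prime F v⟩
  exact multiplicity_mul_logNorm_eq F (residueChar F v) v (natCast_residueChar_mem F v)

/-- Normalised form: `log(𝔡^F) := deg(𝔡^F_ADiv)/[F:ℚ] = (1/[F:ℚ])·Σ_v n_v·d_v·log p_v` ([IUTchIV] Def. 1.9 (i)/(ii)).
[cite: Mochizuki2012, IUTchIV Def. 1.9 p. 21] -/
theorem ndeg_differentDivisor_eq_sum_local :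
    ndeg F (differentDivisor F) =
      (∑ v ∈ (finite_setOf_multiplicity_ne_zero F (differentIdeal_ne_bot' F)).toFinset,
        (haveI : Fact (residueChar F v).Prime := ⟨residueChar_prime F v⟩
         (localDeg F v : ℝ) *
            differentOrd (residueChar F v) (RescaledCompletion F (residueChar F v) v (natCast_residueChar_mem F v)) *
          Real.log (residueChar F v))) / Module.finrank ℚ F := by
  rw [ndeg_apply, degF_differentDivisor_eq_sum_local]

/-- The same over ANY finite set of places containing the support of `𝔇` (off the support the local term vanishes:
`d_v = ord_v(𝔇)/e_v = 0`), e.g. the places over the primes of bad reduction / dividing the discriminant used in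
[IUTchIV] Thm. 1.10. [cite: Mochizuki2012, IUTchIV Def. 1.9 p. 21] -/
theorem degF_differentDivisor_eq_sum_local_of_subset (T : Finset (HeightOneSpectrum (𝓞 F)))
    (hT : ∀ v, multiplicity v.asIdeal (differentIdeal ℤ (𝓞 F)) ≠ 0 → v ∈ T) :
    degF F (differentDivisor F) =
      ∑ v ∈ T,
        (haveI : Fact (residueChar F v).Prime := ⟨residueChar_prime F v⟩
         (localDeg F v : ℝ) *
            differentOrd (residueChar F v) (RescaledCompletion F (residueChar F v) v (natCast_residueChar_mem F v)) *
          Real.log (residueChar F v)) := by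
  rw [degF_differentDivisor_eq_sum_local]
  refine Finset.sum_subset (fun v hv ↦ hT v (by simpa using hv)) fun v _ hv ↦ ?_
  have h0 : multiplicity v.asIdeal (differentIdeal ℤ (𝓞 F)) = 0 := by
    by_contra h
    exact hv (by simpa using h)
  haveI : Fact (residueChar F v).Prime := ⟨residueChar_prime F v⟩
  rw [differentOrd_rescaledCompletion F (residueChar F v) v (natCast_residueChar_mem F v), h0, Nat.cast_zero, zero_div,
    mul_zero, zero_mul]

end Literature.IUT.LogVolume

end
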